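import Summits.QuantumFields.BalabanUV.T4Continuum.Support.NE7DipoleWitnessFrames
import HarnessLib

/-!
# NE7 (pub-balaban, rung (B)+1, d = 4, SU(2), L = 2): THE PURE-GAUGE DIPOLE WITNESS, III — hypothesis (B′) of `hint_SU2_of_dbar` and (B) of `hint_SU2_of_topNormalised` are FALSE;
# the ENDs of record are the merged `hint_SU2_of_dbar'` ∕ `hint_SU2_of_topNormalised'`

Cell `pub-balaban`, rung (B)+1 sub-cell t4, lineage `b2b-balaban-t4-ne7-p1` (CRUX PROVER NE7 #1 = OWNER of row NE7), generation 98; memo `t4/b2b-balaban-t4-ne7-p1-g98/ROAD-G98.md` §3.2.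

WHY.  The un-primed ENDs p745324 ∕ p747587 split the per-pair supplier into «∃ representative» (A)∕(A′) and «∀ representatives, the masses» (B)∕(B′).  THIS FILE proves
(B)∕(B′) FALSE for every `N ≥ 1`, `β > 0`, `α̂ > 0`, all mass letters and every `ε` of the ENDs' regime (`ε ≤ 10⁻¹¹`, `θ_loc·ε < 1`): over the flat datum `D = 1` at `k = 0`
the trivial pair `(1, 1)` has the pure-gauge dipole representative of files I–II (`u` unitary AND corner-trivial, `X` skew periodic, `1^{u} = 1·e^{X}`, `hdbar` AND `v₁ ≡ 1`,
`M·sup‖X‖ ≤ α̂`), whose corrector `μ = −λ` is skew, periodic, corner-vanishing and puts the tangent residual `X − S − R + D_1μ = 0` into `T_♮(1)` (`S = 0`, `R = R_1(0) = 0`),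
while `Σ‖μ‖ ≥ t‖Λ₀‖ > 8|m₁|·C_N·t² ≥ m₁·M³·‖X‖_w²` — **`hypB_dbar_false`**, **`hypB_topNormalised_false`**.  So p745324 ∕ p747587 are correct but VACUOUS as ENDs; row NE7's
ENDs of record are the MERGED forms `NE7HintOfTopNormalisedSU2.hint_SU2_of_topNormalised'` (p748395) ∕ `NE7HintOfDbarSU2.hint_SU2_of_dbar'` (p748379), in which ONE
representative per pair (the one ROAD-Γ′ S1 + S2∕S2′ constructs) carries its own masses — not hit by this witness (for `(U_s, U_s)` take `u = 1`, `X = 0`, `μ = 0`).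
Design consequence (memo §3.2, homogeneity audit): every letter with `‖X‖_w²` right and an un-squared norm left needs first-order slice membership of the representative.

HONEST FRAMING (page 1): an explicit finite witness over landed kernel definitions; nothing of Bałaban's asserted or refuted; NE7 NOT PROVED; spine 0∕9; finite T⁴ rung (B)+1 — NOT
infinite volume, NOT mass gap, NOT `BetaPertH`, NOT Clay.  Continuum YM on T⁴ ⇐ BetaPertH ∧ nine spine estimates (0/9 proved).

WHAT ([folklore]; 0 def, 0 sorry).  `masses_clause_false` (the common hμ-clause at the dipole is contradictory), `hypB_dbar_false`, `hypB_topNormalised_false`.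
-/

namespace Summit.QuantumFields.BalabanUV.T4Continuum.NE7EndHypothesisBWitness

open scoped BigOperators Matrix Matrix.Norms.L2Operator Topology
open NormedSpace Finset

open Literature.MathematicalPhysics.QuantumFieldTheory.Balaban1983to89
open B7Prop1Explicit B7Prop2Explicit B7Prop3Flat MatrixLog UnitaryModel MatrixNorms
open T4AveragingDeficitWall (Ad IsUnitaryCfg IsSkewDir SmallField vary curl curlAt curlSq dirSq)
open T4AveragingDeficitWallBoundary (IsPeriodicCfg periodBox mem_periodBox)
open AveragingDeficitPeriodicCounting (IsPeriodicDir)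
open AveragingDeficitMultiLevelPrep (LevelSmall tower TangentIter cpush)
open AveragingDeficitTransport (mem_U1_of_unitary nReTr_eq_zero_of_mem_skewAdjoint curl_mem_skewAdjoint)
open AveragingDeficitNearIdentity (Ad_one)
open MinimalActionLevels (perWin)
open MinimalActionSandwich (admissible)
open MinimalActionRate (sfClass)
open NE3HessForm (dAction)
open NE3TangentCovariantTower (dirIter framePotW dirIter_one framePotW_one)
open NE3TangentCovariantStructure (Fbar cpush_gaugeDir)
open B7Eq92Concrete (vcov dbavgCovIter dbavgCovIter_succ dbavgCovIter_zero dbavgCov_one_left vcov_succ vcov_zero wframe_one_left)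
open NE3.PairLandauB8Avg (relPert)
open BlockAveragePushDirGauge (gaugeDir isPeriodicDir_gaugeDir)
open NE3CornerSpikes (spikeW)
open NE3QbarIterCovLiftPrep (cruxC)
open NE3SmoothRightInverseW (rightInvW)
open NE3RightInverseSolveLetters (thetaLoc)
open NE3RightInverseLetters (theta_lt_one_of_loc)
open NE3RightInverseSupLetters (norm_rightInvW_le)
open NE3EnergyShapes (IsUnitarySite IsPeriodicSite)
open NE3EnergyWeightedShapes (energyNormW)
open NE3FrameFreeSliceW (frameFreeBlockLandauW)
open NE3FrameFreeDecompositionLinear (zero_mem_frameFreeBlockLandauW)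
open NE3GaugeDirFrames (frameLin_gaugeDir)
open NE3CurlOfGaugeDir (curlAt_gaugeDir)
open NE7ConstantFluxBackground (expUnit_add_smul expUnit_real_smul_mem_unitary)
open NE7HdecompOfTopNormalised (levelSmall_d4_L2 radius_identities)
open B7BlockAvgLog (mlog_exp)
open B8Ineq130 (hol_one Wcx_one bavg_one)

noncomputable section

variable {n : Type} [Fintype n] [DecidableEq n]

open NE7DipoleWitnessField NE7DipoleWitnessFrames

section Witness

/-! ## §1 The two vacuity theorems -/

/-- **THE MASS CLAUSE IS CONTRADICTORY FOR THE DIPOLE**: the common hμ-clause of (B)∕(B′) instantiated at `D = U_s = 1`, `k = 0`, `X = X_dipole(t)` (with `t`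
small against `m₁` and the period box, and `t‖Λ₀‖ < ln 2`) is false — the corrector `μ = −λ` is admissible and breaks the `m₁`-line. [folklore] -/
theorem masses_clause_false [Nonempty n] {ε m₂ p₂ m₁ : ℝ} (hε : 0 < ε) (hε11 : ε ≤ 1 / 10 ^ 11) (hεθ : thetaLoc 4 2 * ε < 1) (N : ℕ) [NeZero N]
    {t : ℝ} (ht0 : 0 < t)
    (htm : 8 * |m₁| * (((periodBox (d := 4) (N * 2 ^ (0 + 1))).card : ℝ) * 4 * (2 * ‖(Lam0 : Matrix n n ℂ)‖) ^ 2) * t < ‖(Lam0 : Matrix n n ℂ)‖)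
    (hμ0 : ∀ (hWu : IsUnitaryCfg (1 : Site 4 → Fin 4 → (Matrix n n ℂ)ˣ)) (hWx : SmallField (1 : Site 4 → Fin 4 → (Matrix n n ℂ)ˣ) (ε / (((2 : ℕ) : ℝ) ^ (0 + 1)) ^ 2)) (hx0 : 0 ≤ ε / (((2 : ℕ) : ℝ) ^ (0 + 1)) ^ 2)
        (hsm0 : LevelSmall 4 2 0 (ε / (((2 : ℕ) : ℝ) ^ (0 + 1)) ^ 2)) (hθ0 : cruxC 4 2 * ((((2 : ℕ) : ℝ) ^ (0 + 1)) ^ 2 * (ε / (((2 : ℕ) : ℝ) ^ (0 + 1)) ^ 2)) < 1)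
        (hYs : IsSkewDir (dirIter 2 (0 + 1) (1 : Site 4 → Fin 4 → (Matrix n n ℂ)ˣ) (fun y ν => (XD (n := n) (N * 2 ^ (0 + 1)) t) y ν - gaugeDir (1 : Site 4 → Fin 4 → (Matrix n n ℂ)ˣ) (spikeW (2 ^ (0 + 1)) (framePotW 2 (0 + 1) (1 : Site 4 → Fin 4 → (Matrix n n ℂ)ˣ) (XD (n := n) (N * 2 ^ (0 + 1)) t))) y ν)))
        (mu : Site 4 → Matrix n n ℂ), (∀ y, mu y ∈ skewAdjoint (Matrix n n ℂ)) →
        (∀ (y : Site 4) (i : Fin 4), mu (y + ((N * 2 ^ (0 + 1) : ℕ) : ℤ) • e i) = mu y) → (∀ w : Site 4, mu ((((2 : ℕ) : ℤ) ^ (0 + 1)) • w) = 0) →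
        (fun y ν => ((XD (n := n) (N * 2 ^ (0 + 1)) t) y ν - (gaugeDir (1 : Site 4 → Fin 4 → (Matrix n n ℂ)ˣ) (spikeW (2 ^ (0 + 1)) (framePotW 2 (0 + 1) (1 : Site 4 → Fin 4 → (Matrix n n ℂ)ˣ) (XD (n := n) (N * 2 ^ (0 + 1)) t))) + rightInvW (le_refl 2) 0 hWu hx0 hsm0 hWx N hθ0 hYs) y ν) + gaugeDir (1 : Site 4 → Fin 4 → (Matrix n n ℂ)ˣ) mu y ν)
          ∈ frameFreeBlockLandauW (d := 4) (n := n) 2 N (0 + 1) (1 : Site 4 → Fin 4 → (Matrix n n ℂ)ˣ) →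
        dirSq (gaugeDir (1 : Site 4 → Fin 4 → (Matrix n n ℂ)ˣ) mu) (periodBox (d := 4) (N * 2 ^ (0 + 1))) ≤ m₂ * (((2 : ℕ) : ℝ) ^ (0 + 1)) ^ 2 * energyNormW 2 (0 + 1) (1 : Site 4 → Fin 4 → (Matrix n n ℂ)ˣ) (XD (n := n) (N * 2 ^ (0 + 1)) t) (periodBox (d := 4) (N * 2 ^ (0 + 1))) ^ 2
        ∧ ∑ z ∈ periodBox (d := 4) (N * 2 ^ (0 + 1)), ‖mu z‖ ^ 2 ≤ p₂ * (((2 : ℕ) : ℝ) ^ (0 + 1)) ^ 4 * energyNormW 2 (0 + 1) (1 : Site 4 → Fin 4 → (Matrix n n ℂ)ˣ) (XD (n := n) (N * 2 ^ (0 + 1)) t) (periodBox (d := 4) (N * 2 ^ (0 + 1))) ^ 2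
        ∧ ∑ z ∈ periodBox (d := 4) (N * 2 ^ (0 + 1)), ‖mu z‖ ≤ m₁ * (((2 : ℕ) : ℝ) ^ (0 + 1)) ^ 3 * energyNormW 2 (0 + 1) (1 : Site 4 → Fin 4 → (Matrix n n ℂ)ˣ) (XD (n := n) (N * 2 ^ (0 + 1)) t) (periodBox (d := 4) (N * 2 ^ (0 + 1))) ^ 2) :
    False := by
  have hN1 : 1 ≤ N := Nat.one_le_iff_ne_zero.mpr (NeZero.ne N)
  have hPM : N * 2 ^ (0 + 1) = 2 * N := by ring
  have hP2 : 2 ∣ N * 2 ^ (0 + 1) := ⟨N, hPM⟩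
  have hPge : 2 ≤ N * 2 ^ (0 + 1) := by rw [hPM]; omega
  have hWu : IsUnitaryCfg (1 : Site 4 → Fin 4 → (Matrix n n ℂ)ˣ) := fun _ _ => Subgroup.one_mem _
  have hSF : ∀ a : ℝ, 0 ≤ a → SmallField (1 : Site 4 → Fin 4 → (Matrix n n ℂ)ˣ) a := fun a ha x κ κ' _ => by rw [hol_one]; simpa using ha
  -- the class lines at `k = 0`
  have hx0 : 0 ≤ ε / (((2 : ℕ) : ℝ) ^ (0 + 1)) ^ 2 := by positivity
  have hsm0 : LevelSmall 4 2 0 (ε / (((2 : ℕ) : ℝ) ^ (0 + 1)) ^ 2) := levelSmall_d4_L2 hε.le hε11 0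
  have hid := radius_identities 0 ε
  have hθl0 : thetaLoc 4 2 * ((((2 : ℕ) : ℝ) ^ (0 + 1)) ^ 2 * (ε / (((2 : ℕ) : ℝ) ^ (0 + 1)) ^ 2)) < 1 := by rw [hid.2]; exact hεθ
  have hθ0 : cruxC 4 2 * ((((2 : ℕ) : ℝ) ^ (0 + 1)) ^ 2 * (ε / (((2 : ℕ) : ℝ) ^ (0 + 1)) ^ 2)) < 1 := theta_lt_one_of_loc (d := 4) 0 hx0 hθl0
  have hWx : SmallField (1 : Site 4 → Fin 4 → (Matrix n n ℂ)ˣ) (ε / (((2 : ℕ) : ℝ) ^ (0 + 1)) ^ 2) := hSF _ hx0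
  have hφ0 := datum_XD (n := n) (P := N * 2 ^ (0 + 1)) N hPM t
  have hYs : IsSkewDir (dirIter 2 (0 + 1) (1 : Site 4 → Fin 4 → (Matrix n n ℂ)ˣ)
      (fun y ν => XD (n := n) (N * 2 ^ (0 + 1)) t y ν - gaugeDir 1 (spikeW (2 ^ (0 + 1)) (framePotW 2 (0 + 1) 1 (XD (n := n) (N * 2 ^ (0 + 1)) t))) y ν)) := by
    rw [hφ0]; exact fun _ _ => (skewAdjoint _).zero_mem
  -- the right-inverse residual of the zero datum vanishes
  have hR0 : ∀ (y : Site 4) (μ : Fin 4), rightInvW (le_refl 2) 0 hWu hx0 hsm0 hWx N hθ0 hYs y μ = 0 := by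
    intro y μ
    have hε1 : (((2 : ℕ) : ℝ) ^ (0 + 1)) ^ 2 * (ε / (((2 : ℕ) : ℝ) ^ (0 + 1)) ^ 2) ≤ 1 := by rw [hid.2]; linarith
    have h := norm_rightInvW_le (d := 4) (le_refl 2) 0 hWu hx0 hsm0 hWx N hθ0 hε1 hYs le_rfl (fun z κ => by rw [hφ0, norm_zero]) y μ
    rw [mul_zero] at h
    exact norm_le_zero_iff.mp h
  -- the corrector `μ = −λ` puts the tangent residual into the slice (to `0`)
  have hmem : (fun y ν => (XD (n := n) (N * 2 ^ (0 + 1)) t y ν - (gaugeDir 1 (spikeW (2 ^ (0 + 1)) (framePotW 2 (0 + 1) 1 (XD (n := n) (N * 2 ^ (0 + 1)) t)))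
        + rightInvW (le_refl 2) 0 hWu hx0 hsm0 hWx N hθ0 hYs) y ν) + gaugeDir 1 (fun y => -lamD (N * 2 ^ (0 + 1)) t y) y ν)
      ∈ frameFreeBlockLandauW (d := 4) (n := n) 2 N (0 + 1) 1 := by
    have h0 : (fun y ν => (XD (n := n) (N * 2 ^ (0 + 1)) t y ν - (gaugeDir 1 (spikeW (2 ^ (0 + 1)) (framePotW 2 (0 + 1) 1 (XD (n := n) (N * 2 ^ (0 + 1)) t)))
        + rightInvW (le_refl 2) 0 hWu hx0 hsm0 hWx N hθ0 hYs) y ν) + gaugeDir 1 (fun y => -lamD (N * 2 ^ (0 + 1)) t y) y ν)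
        = fun _ _ => 0 := by
      funext y ν
      have hS := congr_fun (congr_fun (spikes_XD (n := n) hP2 t) y) ν
      rw [Pi.add_apply, Pi.add_apply, hR0 y ν, hS]
      simp only [add_zero, sub_zero, XD_apply, gaugeDir, Pi.one_apply, inv_one, Ad_one]
      abel
    rw [h0]
    exact zero_mem_frameFreeBlockLandauW (by norm_num) 0 hWu hx0 hsm0 hWx
  obtain ⟨-, -, h3⟩ := hμ0 hWu hWx hx0 hsm0 hθ0 hYs (fun y => -lamD (N * 2 ^ (0 + 1)) t y) (fun y => (skewAdjoint _).neg_mem (lamD_mem _ t y))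
    (fun y i => by rw [lamD_periodic]) (fun w => by
      have : (((2 : ℕ) : ℤ) ^ (0 + 1)) • w = (2 : ℤ) • w := by norm_num
      rw [this, lamD_corner hP2, neg_zero]) hmem
  simp_rw [norm_neg] at h3
  have h3' : ∑ z ∈ periodBox (d := 4) (N * 2 ^ (0 + 1)), ‖-(lamD (N * 2 ^ (0 + 1)) t z : Matrix n n ℂ)‖
      ≤ m₁ * (((2 : ℕ) : ℝ) ^ (0 + 1)) ^ 3 * energyNormW 2 (0 + 1) (1 : Site 4 → Fin 4 → (Matrix n n ℂ)ˣ) (XD (n := n) (N * 2 ^ (0 + 1)) t) (periodBox (d := 4) (N * 2 ^ (0 + 1))) ^ 2 := by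
    simp_rw [norm_neg]; exact h3
  exact m1_line_false hPge _ (siteA_mem_periodBox hPge) ht0 htm h3'

/-- **(B′) OF `hint_SU2_of_dbar` IS FALSE** (every `N ≥ 1`, `β > 0`, `α̂ > 0`, every `m₂ p₂ m₁ Θ₂ Θ₁`, every `ε > 0` of the END's regime): the pure-gauge dipole
representative of the trivial pair `(1, 1)` over the datum `D = 1` at `k = 0` satisfies its premises (ANY unitary gauge, `hdbar`) and violates its `m₁`-line.  Hence p747587
is vacuous as an END; the END of record in S2′'s currency is `NE7HintOfDbarSU2.hint_SU2_of_dbar'` (p748379). [folklore] -/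
theorem hypB_dbar_false [Nonempty n] {ε β αh m₂ p₂ m₁ Θ₂ Θ₁ : ℝ} (hε : 0 < ε) (hε11 : ε ≤ 1 / 10 ^ 11) (hεθ : thetaLoc 4 2 * ε < 1)
    (hβ : 0 < β) (N : ℕ) [NeZero N] (hαh : 0 < αh)
    (hB : ∀ D : Site 4 → Fin 4 → (Matrix n n ℂ)ˣ, IsUnitaryCfg D → IsPeriodicCfg D (N : ℤ) → SmallField D (4 * (Real.exp β - 1)) → ∀ (k : ℕ), ∀ Us ∈ admissible (sfClass 4 2 N ε) 2 (k + 1) D, SmallField Us ((1 / ((2 : ℕ) : ℝ) ^ 2 * ε / 2) / (((2 : ℕ) : ℝ) ^ (k + 1)) ^ 2) → (∀ φ : Site 4 → Fin 4 → Matrix n n ℂ, IsSkewDir φ → IsPeriodicDir φ ((N * 2 ^ (k + 1) : ℕ) : ℤ) → TangentIter 2 k Us φ → dAction Us φ (perWin 4 (N * 2 ^ (k + 1))) = 0) → ∀ U' ∈ admissible (sfClass 4 2 N ε) 2 (k + 1) D,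
      ∀ (u : Site 4 → (Matrix n n ℂ)ˣ) (X : Site 4 → Fin 4 → Matrix n n ℂ) (b : ℝ),
        IsUnitarySite u → IsSkewDir X → IsPeriodicDir X ((N * 2 ^ (k + 1) : ℕ) : ℤ) → 0 ≤ b →
        (∀ x μ, ‖X x μ‖ ≤ b) → gaugeAct u U' = vary Us X 1 → dbavgCovIter 2 Us (relPert Us X) (k + 1) = 1 → ((2 : ℕ) : ℝ) ^ (k + 1) * b ≤ αh →
      (∑ z ∈ periodBox (d := 4) N, ‖mlog ((vcov 2 Us (relPert Us X) (k + 1) z : (Matrix n n ℂ)ˣ) : Matrix n n ℂ)‖ ^ 2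
          ≤ Θ₂ * (((2 : ℕ) : ℝ) ^ (k + 1)) ^ 2 * energyNormW 2 (k + 1) Us X (periodBox (d := 4) (N * 2 ^ (k + 1))) ^ 2
        ∧ ∑ z ∈ periodBox (d := 4) N, ‖mlog ((vcov 2 Us (relPert Us X) (k + 1) z : (Matrix n n ℂ)ˣ) : Matrix n n ℂ)‖
          ≤ Θ₁ * (((2 : ℕ) : ℝ) ^ (k + 1)) ^ 2 * energyNormW 2 (k + 1) Us X (periodBox (d := 4) (N * 2 ^ (k + 1))) ^ 2) ∧
      ∀ (hWu : IsUnitaryCfg Us) (hWx : SmallField Us (ε / (((2 : ℕ) : ℝ) ^ (k + 1)) ^ 2)) (hx0 : 0 ≤ ε / (((2 : ℕ) : ℝ) ^ (k + 1)) ^ 2)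
        (hsm0 : LevelSmall 4 2 k (ε / (((2 : ℕ) : ℝ) ^ (k + 1)) ^ 2)) (hθ0 : cruxC 4 2 * ((((2 : ℕ) : ℝ) ^ (k + 1)) ^ 2 * (ε / (((2 : ℕ) : ℝ) ^ (k + 1)) ^ 2)) < 1)
        (hYs : IsSkewDir (dirIter 2 (k + 1) Us (fun y ν => X y ν - gaugeDir Us (spikeW (2 ^ (k + 1)) (framePotW 2 (k + 1) Us X)) y ν)))
        (mu : Site 4 → Matrix n n ℂ), (∀ y, mu y ∈ skewAdjoint (Matrix n n ℂ)) →
        (∀ (y : Site 4) (i : Fin 4), mu (y + ((N * 2 ^ (k + 1) : ℕ) : ℤ) • e i) = mu y) → (∀ w : Site 4, mu ((((2 : ℕ) : ℤ) ^ (k + 1)) • w) = 0) →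
        (fun y ν => (X y ν - (gaugeDir Us (spikeW (2 ^ (k + 1)) (framePotW 2 (k + 1) Us X)) + rightInvW (le_refl 2) k hWu hx0 hsm0 hWx N hθ0 hYs) y ν) + gaugeDir Us mu y ν)
          ∈ frameFreeBlockLandauW (d := 4) (n := n) 2 N (k + 1) Us →
        dirSq (gaugeDir Us mu) (periodBox (d := 4) (N * 2 ^ (k + 1))) ≤ m₂ * (((2 : ℕ) : ℝ) ^ (k + 1)) ^ 2 * energyNormW 2 (k + 1) Us X (periodBox (d := 4) (N * 2 ^ (k + 1))) ^ 2
        ∧ ∑ z ∈ periodBox (d := 4) (N * 2 ^ (k + 1)), ‖mu z‖ ^ 2 ≤ p₂ * (((2 : ℕ) : ℝ) ^ (k + 1)) ^ 4 * energyNormW 2 (k + 1) Us X (periodBox (d := 4) (N * 2 ^ (k + 1))) ^ 2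
        ∧ ∑ z ∈ periodBox (d := 4) (N * 2 ^ (k + 1)), ‖mu z‖ ≤ m₁ * (((2 : ℕ) : ℝ) ^ (k + 1)) ^ 3 * energyNormW 2 (k + 1) Us X (periodBox (d := 4) (N * 2 ^ (k + 1))) ^ 2) :
    False := by
  -- the period and the numerics of the witness
  have hN1 : 1 ≤ N := Nat.one_le_iff_ne_zero.mpr (NeZero.ne N)
  have hPM : N * 2 ^ (0 + 1) = 2 * N := by ring
  have hP2 : 2 ∣ N * 2 ^ (0 + 1) := ⟨N, hPM⟩
  set L0 : ℝ := ‖(Lam0 : Matrix n n ℂ)‖ with hL0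
  have hL0p : 0 < L0 := norm_Lam0_pos
  set C0 : ℝ := ((periodBox (d := 4) (N * 2 ^ (0 + 1))).card : ℝ) * 4 * (2 * L0) ^ 2 with hC0
  have hC0nn : 0 ≤ C0 := by positivity
  set t : ℝ := min (min (1 / (4 * (L0 + 1))) (αh / (4 * L0 + 1))) (L0 / (16 * (|m₁| + 1) * (C0 + 1))) with ht
  have ht0 : 0 < t := lt_min (lt_min (by positivity) (by positivity)) (by positivity)
  have ht1 : t ≤ 1 / (4 * (L0 + 1)) := (min_le_left _ _).trans (min_le_left _ _)
  have ht2 : t ≤ αh / (4 * L0 + 1) := (min_le_left _ _).trans (min_le_right _ _)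
  have ht3 : t ≤ L0 / (16 * (|m₁| + 1) * (C0 + 1)) := min_le_right _ _
  have htl : t * L0 < Real.log 2 := by
    have h1 : t * L0 ≤ 1 / (4 * (L0 + 1)) * L0 := mul_le_mul_of_nonneg_right ht1 hL0p.le
    have h2 : 1 / (4 * (L0 + 1)) * L0 ≤ 1 / 4 := by
      rw [div_mul_eq_mul_div, one_mul, div_le_iff₀ (by positivity)]; linarith
    linarith [Real.log_two_gt_d9]
  have htα : ((2 : ℕ) : ℝ) ^ (0 + 1) * (2 * (t * L0)) ≤ αh := by
    have h1 : t * (4 * L0 + 1) ≤ αh := by rwa [le_div_iff₀ (by positivity)] at ht2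
    norm_num; nlinarith [hL0p, ht0]
  have htm : 8 * |m₁| * C0 * t < L0 := by
    have h1 : t * (16 * (|m₁| + 1) * (C0 + 1)) ≤ L0 := by rwa [le_div_iff₀ (by positivity)] at ht3
    have h2 : 8 * |m₁| * C0 < 16 * (|m₁| + 1) * (C0 + 1) := by nlinarith [abs_nonneg m₁, hC0nn]
    nlinarith [ht0, abs_nonneg m₁]
  -- the flat datum, the trivial pair
  have hWu : IsUnitaryCfg (1 : Site 4 → Fin 4 → (Matrix n n ℂ)ˣ) := fun _ _ => Subgroup.one_mem _
  have hWP : ∀ Q : ℤ, IsPeriodicCfg (1 : Site 4 → Fin 4 → (Matrix n n ℂ)ˣ) Q := fun _ _ _ _ => rfl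
  have hSF : ∀ a : ℝ, 0 ≤ a → SmallField (1 : Site 4 → Fin 4 → (Matrix n n ℂ)ˣ) a := fun a ha x κ κ' _ => by rw [hol_one]; simpa using ha
  have hadm : (1 : Site 4 → Fin 4 → (Matrix n n ℂ)ˣ) ∈ admissible (sfClass 4 2 N ε) 2 (0 + 1) 1 := by
    refine ⟨⟨hWu, hWP _, hSF _ (by positivity)⟩, ?_⟩
    funext z κ
    rw [avgIter_succ, rescale_apply, avgIter_zero, bavg_one, Pi.one_apply, Pi.one_apply]
  have hcrit : ∀ φ : Site 4 → Fin 4 → Matrix n n ℂ, IsSkewDir φ → IsPeriodicDir φ ((N * 2 ^ (0 + 1) : ℕ) : ℤ) → TangentIter 2 0 1 φ →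
      dAction (1 : Site 4 → Fin 4 → (Matrix n n ℂ)ˣ) φ (perWin 4 (N * 2 ^ (0 + 1))) = 0 := by
    intro φ hφ _ _
    unfold dAction
    rw [neg_eq_zero]
    refine Finset.sum_eq_zero fun p _ => ?_
    have h1 : ((T4AveragingDeficitWall.fhol (1 : Site 4 → Fin 4 → (Matrix n n ℂ)ˣ) p : (Matrix n n ℂ)ˣ) : Matrix n n ℂ) = 1 := by
      simp [T4AveragingDeficitWall.fhol, hol_one]
    rw [h1, mul_one]
    exact nReTr_eq_zero_of_mem_skewAdjoint (curl_mem_skewAdjoint hWu hφ p)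
  have hDS : SmallField (1 : Site 4 → Fin 4 → (Matrix n n ℂ)ˣ) (4 * (Real.exp β - 1)) :=
    hSF _ (by nlinarith [Real.add_one_le_exp β])
  -- the dipole representative of the pair `(1, 1)`
  have hrep : gaugeAct (uD (n := n) (N * 2 ^ (0 + 1)) t) 1 = vary 1 (XD (n := n) (N * 2 ^ (0 + 1)) t) 1 := gaugeAct_uD _ t
  have hdbar : dbavgCovIter 2 (1 : Site 4 → Fin 4 → (Matrix n n ℂ)ˣ) (relPert 1 (XD (n := n) (N * 2 ^ (0 + 1)) t)) (0 + 1) = 1 := by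
    rw [relPert_XD]; exact dbavgCovIter_one hP2 ht0.le htl
  obtain ⟨-, hμ0⟩ := hB 1 hWu (hWP _) hDS 0 1 hadm (hSF _ (by positivity)) hcrit 1 hadm (uD (N * 2 ^ (0 + 1)) t) (XD (N * 2 ^ (0 + 1)) t)
    (2 * (t * L0)) (uD_unitary _ t) (XD_skew _ t) (XD_periodic _ t) (by positivity) (norm_XD_le _ ht0.le) hrep hdbar htα
  exact masses_clause_false hε hε11 hεθ N ht0 htm hμ0

/-- **(B) OF `hint_SU2_of_topNormalised` IS FALSE** (same data): the dipole gauge is CORNER-TRIVIAL and its accumulated top frame is `v₁ ≡ 1`, so the dipole representative also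
satisfies the premises of (B); its `m₁`-line fails identically.  Hence p745324 is vacuous as an END; the END of record in S2's currency is
`NE7HintOfTopNormalisedSU2.hint_SU2_of_topNormalised'` (p748395). [folklore] -/
theorem hypB_topNormalised_false [Nonempty n] {ε β αh m₂ p₂ m₁ : ℝ} (hε : 0 < ε) (hε11 : ε ≤ 1 / 10 ^ 11) (hεθ : thetaLoc 4 2 * ε < 1)
    (hβ : 0 < β) (N : ℕ) [NeZero N] (hαh : 0 < αh)
    (hB : ∀ D : Site 4 → Fin 4 → (Matrix n n ℂ)ˣ, IsUnitaryCfg D → IsPeriodicCfg D (N : ℤ) → SmallField D (4 * (Real.exp β - 1)) → ∀ (k : ℕ), ∀ Us ∈ admissible (sfClass 4 2 N ε) 2 (k + 1) D, SmallField Us ((1 / ((2 : ℕ) : ℝ) ^ 2 * ε / 2) / (((2 : ℕ) : ℝ) ^ (k + 1)) ^ 2) → (∀ φ : Site 4 → Fin 4 → Matrix n n ℂ, IsSkewDir φ → IsPeriodicDir φ ((N * 2 ^ (k + 1) : ℕ) : ℤ) → TangentIter 2 k Us φ → dAction Us φ (perWin 4 (N * 2 ^ (k + 1))) = 0) → ∀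 U' ∈ admissible (sfClass 4 2 N ε) 2 (k + 1) D,
      ∀ (u : Site 4 → (Matrix n n ℂ)ˣ) (X : Site 4 → Fin 4 → Matrix n n ℂ) (b : ℝ),
        IsUnitarySite u → (∀ z : Site 4, u ((((2 : ℕ) : ℤ) ^ (k + 1)) • z) = 1) → IsSkewDir X → IsPeriodicDir X ((N * 2 ^ (k + 1) : ℕ) : ℤ) → 0 ≤ b →
        (∀ x μ, ‖X x μ‖ ≤ b) → gaugeAct u U' = vary Us X 1 → (∀ z : Site 4, vcov 2 Us (relPert Us X) (k + 1) z = 1) → ((2 : ℕ) : ℝ) ^ (k + 1) * b ≤ αh →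
      ∀ (hWu : IsUnitaryCfg Us) (hWx : SmallField Us (ε / (((2 : ℕ) : ℝ) ^ (k + 1)) ^ 2)) (hx0 : 0 ≤ ε / (((2 : ℕ) : ℝ) ^ (k + 1)) ^ 2)
        (hsm0 : LevelSmall 4 2 k (ε / (((2 : ℕ) : ℝ) ^ (k + 1)) ^ 2)) (hθ0 : cruxC 4 2 * ((((2 : ℕ) : ℝ) ^ (k + 1)) ^ 2 * (ε / (((2 : ℕ) : ℝ) ^ (k + 1)) ^ 2)) < 1)
        (hYs : IsSkewDir (dirIter 2 (k + 1) Us (fun y ν => X y ν - gaugeDir Us (spikeW (2 ^ (k + 1)) (framePotW 2 (k + 1) Us X)) y ν)))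
        (mu : Site 4 → Matrix n n ℂ), (∀ y, mu y ∈ skewAdjoint (Matrix n n ℂ)) →
        (∀ (y : Site 4) (i : Fin 4), mu (y + ((N * 2 ^ (k + 1) : ℕ) : ℤ) • e i) = mu y) → (∀ w : Site 4, mu ((((2 : ℕ) : ℤ) ^ (k + 1)) • w) = 0) →
        (fun y ν => (X y ν - (gaugeDir Us (spikeW (2 ^ (k + 1)) (framePotW 2 (k + 1) Us X)) + rightInvW (le_refl 2) k hWu hx0 hsm0 hWx N hθ0 hYs) y ν) + gaugeDir Us mu y ν)
          ∈ frameFreeBlockLandauW (d := 4) (n := n) 2 N (k + 1) Us →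
        dirSq (gaugeDir Us mu) (periodBox (d := 4) (N * 2 ^ (k + 1))) ≤ m₂ * (((2 : ℕ) : ℝ) ^ (k + 1)) ^ 2 * energyNormW 2 (k + 1) Us X (periodBox (d := 4) (N * 2 ^ (k + 1))) ^ 2
        ∧ ∑ z ∈ periodBox (d := 4) (N * 2 ^ (k + 1)), ‖mu z‖ ^ 2 ≤ p₂ * (((2 : ℕ) : ℝ) ^ (k + 1)) ^ 4 * energyNormW 2 (k + 1) Us X (periodBox (d := 4) (N * 2 ^ (k + 1))) ^ 2
        ∧ ∑ z ∈ periodBox (d := 4) (N * 2 ^ (k + 1)), ‖mu z‖ ≤ m₁ * (((2 : ℕ) : ℝ) ^ (k + 1)) ^ 3 * energyNormW 2 (k + 1) Us X (periodBox (d := 4) (N * 2 ^ (k + 1))) ^ 2) :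
    False := by
  -- the period and the numerics of the witness
  have hN1 : 1 ≤ N := Nat.one_le_iff_ne_zero.mpr (NeZero.ne N)
  have hPM : N * 2 ^ (0 + 1) = 2 * N := by ring
  have hP2 : 2 ∣ N * 2 ^ (0 + 1) := ⟨N, hPM⟩
  set L0 : ℝ := ‖(Lam0 : Matrix n n ℂ)‖ with hL0
  have hL0p : 0 < L0 := norm_Lam0_pos
  set C0 : ℝ := ((periodBox (d := 4) (N * 2 ^ (0 + 1))).card : ℝ) * 4 * (2 * L0) ^ 2 with hC0
  have hC0nn : 0 ≤ C0 := by positivity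
  set t : ℝ := min (min (1 / (4 * (L0 + 1))) (αh / (4 * L0 + 1))) (L0 / (16 * (|m₁| + 1) * (C0 + 1))) with ht
  have ht0 : 0 < t := lt_min (lt_min (by positivity) (by positivity)) (by positivity)
  have ht1 : t ≤ 1 / (4 * (L0 + 1)) := (min_le_left _ _).trans (min_le_left _ _)
  have ht2 : t ≤ αh / (4 * L0 + 1) := (min_le_left _ _).trans (min_le_right _ _)
  have ht3 : t ≤ L0 / (16 * (|m₁| + 1) * (C0 + 1)) := min_le_right _ _
  have htl : t * L0 < Real.log 2 := by
    have h1 : t * L0 ≤ 1 / (4 * (L0 + 1)) * L0 := mul_le_mul_of_nonneg_right ht1 hL0p.le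
    have h2 : 1 / (4 * (L0 + 1)) * L0 ≤ 1 / 4 := by
      rw [div_mul_eq_mul_div, one_mul, div_le_iff₀ (by positivity)]; linarith
    linarith [Real.log_two_gt_d9]
  have htα : ((2 : ℕ) : ℝ) ^ (0 + 1) * (2 * (t * L0)) ≤ αh := by
    have h1 : t * (4 * L0 + 1) ≤ αh := by rwa [le_div_iff₀ (by positivity)] at ht2
    norm_num; nlinarith [hL0p, ht0]
  have htm : 8 * |m₁| * C0 * t < L0 := by
    have h1 : t * (16 * (|m₁| + 1) * (C0 + 1)) ≤ L0 := by rwa [le_div_iff₀ (by positivity)] at ht3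
    have h2 : 8 * |m₁| * C0 < 16 * (|m₁| + 1) * (C0 + 1) := by nlinarith [abs_nonneg m₁, hC0nn]
    nlinarith [ht0, abs_nonneg m₁]
  -- the flat datum, the trivial pair
  have hWu : IsUnitaryCfg (1 : Site 4 → Fin 4 → (Matrix n n ℂ)ˣ) := fun _ _ => Subgroup.one_mem _
  have hWP : ∀ Q : ℤ, IsPeriodicCfg (1 : Site 4 → Fin 4 → (Matrix n n ℂ)ˣ) Q := fun _ _ _ _ => rfl
  have hSF : ∀ a : ℝ, 0 ≤ a → SmallField (1 : Site 4 → Fin 4 → (Matrix n n ℂ)ˣ) a := fun a ha x κ κ' _ => by rw [hol_one]; simpa using ha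
  have hadm : (1 : Site 4 → Fin 4 → (Matrix n n ℂ)ˣ) ∈ admissible (sfClass 4 2 N ε) 2 (0 + 1) 1 := by
    refine ⟨⟨hWu, hWP _, hSF _ (by positivity)⟩, ?_⟩
    funext z κ
    rw [avgIter_succ, rescale_apply, avgIter_zero, bavg_one, Pi.one_apply, Pi.one_apply]
  have hcrit : ∀ φ : Site 4 → Fin 4 → Matrix n n ℂ, IsSkewDir φ → IsPeriodicDir φ ((N * 2 ^ (0 + 1) : ℕ) : ℤ) → TangentIter 2 0 1 φ →
      dAction (1 : Site 4 → Fin 4 → (Matrix n n ℂ)ˣ) φ (perWin 4 (N * 2 ^ (0 + 1))) = 0 := by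
    intro φ hφ _ _
    unfold dAction
    rw [neg_eq_zero]
    refine Finset.sum_eq_zero fun p _ => ?_
    have h1 : ((T4AveragingDeficitWall.fhol (1 : Site 4 → Fin 4 → (Matrix n n ℂ)ˣ) p : (Matrix n n ℂ)ˣ) : Matrix n n ℂ) = 1 := by
      simp [T4AveragingDeficitWall.fhol, hol_one]
    rw [h1, mul_one]
    exact nReTr_eq_zero_of_mem_skewAdjoint (curl_mem_skewAdjoint hWu hφ p)
  have hDS : SmallField (1 : Site 4 → Fin 4 → (Matrix n n ℂ)ˣ) (4 * (Real.exp β - 1)) :=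
    hSF _ (by nlinarith [Real.add_one_le_exp β])
  -- the dipole representative of the pair `(1, 1)`
  have hrep : gaugeAct (uD (n := n) (N * 2 ^ (0 + 1)) t) 1 = vary 1 (XD (n := n) (N * 2 ^ (0 + 1)) t) 1 := gaugeAct_uD _ t
  have hcorner : ∀ z : Site 4, uD (n := n) (N * 2 ^ (0 + 1)) t ((((2 : ℕ) : ℤ) ^ (0 + 1)) • z) = 1 := fun z => by
    have : (((2 : ℕ) : ℤ) ^ (0 + 1)) • z = (2 : ℤ) • z := by norm_num
    rw [this]; exact uD_corner hP2 t z
  have hv1 : ∀ z : Site 4, vcov 2 (1 : Site 4 → Fin 4 → (Matrix n n ℂ)ˣ) (relPert 1 (XD (n := n) (N * 2 ^ (0 + 1)) t)) (0 + 1) z = 1 := fun z => by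
    rw [relPert_XD]; exact vcov_one hP2 ht0.le htl z
  have hμ0 := hB 1 hWu (hWP _) hDS 0 1 hadm (hSF _ (by positivity)) hcrit 1 hadm (uD (N * 2 ^ (0 + 1)) t) (XD (N * 2 ^ (0 + 1)) t)
    (2 * (t * L0)) (uD_unitary _ t) hcorner (XD_skew _ t) (XD_periodic _ t) (by positivity) (norm_XD_le _ ht0.le) hrep hv1 htα
  exact masses_clause_false hε hε11 hεθ N ht0 htm hμ0

end Witness

end

end Summit.QuantumFields.BalabanUV.T4Continuum.NE7EndHypothesisBWitness
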